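import Literature.Barriers.AtomisticToContinuum.DisorderedHarmonicChainVariations
import Literature.Barriers.AtomisticToContinuum.DisorderedHarmonicChainIBP
import Literature.Barriers.AtomisticToContinuum.DisorderedHarmonicChainSweep
import Literature.Barriers.AtomisticToContinuum.DisorderedHarmonicChainExpMoments
import Mathlib.MeasureTheory.Function.JacobianOneDim
import Mathlib.MeasureTheory.Integral.IntervalIntegral.Periodic
import Mathlib.Analysis.Complex.ExponentialBounds
import HarnessLib

/-!
# Ajanki–Huveneers 2011: the crude density bound `𝔼 g(X_m) ≤ (C/w) ∫_𝕋 g` for the phase chain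

Eighth file of the integration-by-parts route to the low-frequency upper bound (U) of
`…Transfer.lean` (O. Ajanki, F. Huveneers, CMP **301** (2011) 841–883, arXiv:1003.1076). Lemma
5.4 of the paper, eq. (5.15), states `‖Tu‖_∞ ≤ K' w⁻¹ ‖u‖₁` for `u` supported away from `0`: one
step of the chain already spreads mass at scale `w`, by the change of variables `b ↦ f_b(x)`,
`∂_b f_b(x) ≳ w`. We PROVE the unconditional `m`-step form we need:

* `lintegral_pi_update` (resampling one coordinate, `ℝ≥0∞` version of `integral_pi_update`),
  `finExt_update`, integrals of `1`-periodic functions over unit intervals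
  (`lintegral_Ioc_add_one_eq_of_periodic`, `lintegral_Icc_le_of_periodic`);
* `lintegral_comp_le_of_deriv_ge`: the one-dimensional pushforward bound — for `ψ ∈ C¹[b₋,b₊]`
  with `ψ' ≥ c > 0` and `ψ(b₊) - ψ(b₋) ≤ 1`, `τ ≤ τ_max`, and `g ≥ 0` measurable `1`-periodic,
  `∫ g(ψ(t)) τ(t) dt ≤ (τ_max/c) ∫_𝕋 g` (change of variables `lintegral_image_eq_lintegral_abs_deriv_mul`);
* `crude_density_bound`: for `κ > 0` there are `w₀ > 0`, `C` with
  `𝔼 g(X^x_m) ≤ (C/w) ∫_𝕋 g` for all `0 < w ≤ w₀`, `wm ≥ κ`, all `x`, all measurable `1`-periodic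
  `g ≥ 0` — by resampling the FIRST reduced mass `B_{k*}` in the last window of `≍ 1/w` steps at
  which `sin²(πX_{k*}) ≥ 4η²` (it exists by the sweep count of `…Sweep.lean`; the event
  "`k*` is the first such index" does not read `B_{k*}`), along which
  `∂X_m/∂B_{k*} = u_{k*} J_m c(w)/(π J_{k*}) ≥ η² w` (`…Variations.lean`; the cocycle over `≤ c₀/w`
  steps is `≥ e⁻¹`).

[cite: AjankiHuveneers2011, Lemma 5.4 eq. (5.15) and its proof (`∂_b F_x(b) ≳ w`); Cor. 3.4 (i)]
-/

noncomputable section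

open Real MeasureTheory Set Filter Function Finset
open scoped ENNReal

namespace Literature.Barriers.AtomisticToContinuum.HeatConduction

/-! ### Resampling one coordinate, `ℝ≥0∞` version; `finExt` and `update` -/

section Resample

variable (ρ : Measure ℝ) [IsProbabilityMeasure ρ]

/-- **Resampling one coordinate** (`ℝ≥0∞`): `∫⁻ F dρ^{⊗(n+1)} = ∫⁻ (∫⁻ F(B[k ↦ b]) ρ(db)) ρ^{⊗(n+1)}(dB)`
for measurable `F ≥ 0`. [folklore] -/
theorem lintegral_pi_update {n : ℕ} (k : Fin (n + 1)) (F : (Fin (n + 1) → ℝ) → ℝ≥0∞)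
    (hF : Measurable F) :
    ∫⁻ B, F B ∂(Measure.pi fun _ : Fin (n + 1) => ρ) =
      ∫⁻ B, (∫⁻ b, F (Function.update B k b) ∂ρ) ∂(Measure.pi fun _ : Fin (n + 1) => ρ) := by
  set e := MeasurableEquiv.piFinSuccAbove (fun _ : Fin (n + 1) => ℝ) k with he
  have hmp : MeasurePreserving e (Measure.pi fun _ : Fin (n + 1) => ρ)
      (ρ.prod (Measure.pi fun _ : Fin n => ρ)) :=
    measurePreserving_piFinSuccAbove (fun _ : Fin (n + 1) => ρ) k
  have hmp' := hmp.symm e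
  set G' : (Fin n → ℝ) → ℝ≥0∞ := fun B' => ∫⁻ b, F (e.symm (b, B')) ∂ρ with hG'
  have hFe : Measurable fun p : ℝ × (Fin n → ℝ) => F (e.symm p) := hF.comp e.symm.measurable
  have hG'm : Measurable G' := hFe.lintegral_prod_left'
  have hR : (fun B : Fin (n + 1) → ℝ => ∫⁻ b, F (Function.update B k b) ∂ρ) = fun B => G' (e B).2 := by
    funext B
    simp only [hG']
    refine lintegral_congr fun b => ?_
    rw [update_eq_piFinSuccAbove_symm]
  rw [hR]
  have hL : ∫⁻ B, F B ∂(Measure.pi fun _ : Fin (n + 1) => ρ) =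
      ∫⁻ B', G' B' ∂(Measure.pi fun _ : Fin n => ρ) := by
    rw [← hmp'.lintegral_comp_emb e.symm.measurableEmbedding, lintegral_prod_symm _ hFe.aemeasurable]
  rw [hL]
  have hR2 : ∫⁻ B, G' (e B).2 ∂(Measure.pi fun _ : Fin (n + 1) => ρ) =
      ∫⁻ p, G' p.2 ∂(ρ.prod (Measure.pi fun _ : Fin n => ρ)) := by
    rw [← hmp.lintegral_comp_emb e.measurableEmbedding]
  rw [hR2, lintegral_prod_symm (fun p : ℝ × (Fin n → ℝ) => G' p.2) (hG'm.comp measurable_snd).aemeasurable]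
  simp only [lintegral_const, measure_univ, mul_one]

/-- `finExt (b[k ↦ t]) = (finExt b)[k ↦ t]`. [folklore] -/
theorem finExt_update {n : ℕ} (b : Fin n → ℝ) (k : Fin n) (t : ℝ) :
    finExt (Function.update b k t) = Function.update (finExt b) k.val t := by
  funext i
  by_cases hi : i < n
  · rw [finExt_of_lt _ hi]
    by_cases hik : i = k.val
    · subst hik
      rw [Function.update_self, Function.update_self]
    · rw [Function.update_of_ne hik, finExt_of_lt _ hi, Function.update_of_ne]
      exact fun h => hik (congrArg Fin.val h)
  · have hik : i ≠ k.val := fun h => hi (h ▸ k.isLt)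
    rw [Function.update_of_ne hik]
    simp only [finExt, hi, ↓reduceDIte]

end Resample

/-! ### Integrals of `1`-periodic functions over unit intervals -/

section Periodic

/-- `∫⁻_{(t, t+1]} g = ∫⁻_{(0, 1]} g` for `1`-periodic `g`. [folklore] -/
theorem lintegral_Ioc_add_one_eq_of_periodic {g : ℝ → ℝ≥0∞} (hg : Function.Periodic g 1) (t : ℝ) :
    ∫⁻ a in Set.Ioc t (t + 1), g a = ∫⁻ a in Set.Ioc 0 1, g a := by
  have h1 := UnitAddCircle.lintegral_preimage t hg.lift
  have h0 := UnitAddCircle.lintegral_preimage 0 hg.lift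
  simp only [Function.Periodic.lift_coe, zero_add] at h1 h0
  rw [h1, h0]

/-- An interval of length `≤ 1` carries at most one period: `∫⁻_{[a, c]} g ≤ ∫⁻_{(0,1]} g` for
`c ≤ a + 1`, `g` `1`-periodic. [folklore] -/
theorem lintegral_Icc_le_of_periodic {g : ℝ → ℝ≥0∞} (hg : Function.Periodic g 1) {a c : ℝ}
    (h : c ≤ a + 1) : ∫⁻ y in Set.Icc a c, g y ≤ ∫⁻ y in Set.Ioc 0 1, g y := by
  calc ∫⁻ y in Set.Icc a c, g y ≤ ∫⁻ y in Set.Icc a (a + 1), g y :=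
        lintegral_mono_set (Set.Icc_subset_Icc le_rfl h)
    _ = ∫⁻ y in Set.Ioc a (a + 1), g y := (setLIntegral_congr Ioc_ae_eq_Icc).symm
    _ = ∫⁻ y in Set.Ioc 0 1, g y := lintegral_Ioc_add_one_eq_of_periodic hg a

end Periodic

/-! ### The one-dimensional pushforward bound -/

section Pushforward

/-- **One coordinate spreads mass at the scale of its Jacobian**: for `ψ ∈ C¹[b₋, b₊]` with
`ψ' ≥ c > 0`, `ψ(b₊) - ψ(b₋) ≤ 1`, a density `0 ≤ τ ≤ τ_max` vanishing off `[b₋, b₊]`, and a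
measurable `1`-periodic `g ≥ 0`: `∫ g(ψ(t)) τ(t) dt ≤ (τ_max/c) ∫_{(0,1]} g`.
[cite: AjankiHuveneers2011, Lemma 5.4 eq. (5.15) (proof: change of variables `b ↦ f_b(x)`)] -/
theorem lintegral_comp_le_of_deriv_ge {ψ ψ' : ℝ → ℝ} {bm bp c τmax : ℝ} (hle : bm ≤ bp) (hc : 0 < c)
    (hψ : ∀ t ∈ Set.Icc bm bp, HasDerivAt ψ (ψ' t) t) (hψ' : ∀ t ∈ Set.Icc bm bp, c ≤ ψ' t)
    (hlen : ψ bp - ψ bm ≤ 1) {τ : ℝ → ℝ} (hτ0 : ∀ t, 0 ≤ τ t) (hτmax : ∀ t, τ t ≤ τmax)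
    (hτoff : ∀ t ∉ Set.Icc bm bp, τ t = 0) {g : ℝ → ℝ≥0∞} (hg : Function.Periodic g 1) :
    ∫⁻ t, g (ψ t) * ENNReal.ofReal (τ t) ≤ ENNReal.ofReal (τmax / c) * ∫⁻ y in Set.Ioc 0 1, g y := by
  have hτmax0 : 0 ≤ τmax := (hτ0 0).trans (hτmax 0)
  -- restrict to the support
  have h1 : ∫⁻ t, g (ψ t) * ENNReal.ofReal (τ t) = ∫⁻ t in Set.Icc bm bp, g (ψ t) * ENNReal.ofReal (τ t) := by
    rw [← lintegral_indicator measurableSet_Icc]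
    refine lintegral_congr fun t => ?_
    by_cases ht : t ∈ Set.Icc bm bp
    · rw [Set.indicator_of_mem ht]
    · rw [Set.indicator_of_notMem ht, hτoff t ht, ENNReal.ofReal_zero, mul_zero]
  rw [h1]
  -- bound the density by the Jacobian
  have h2 : ∫⁻ t in Set.Icc bm bp, g (ψ t) * ENNReal.ofReal (τ t) ≤
      ∫⁻ t in Set.Icc bm bp, ENNReal.ofReal (τmax / c) * (ENNReal.ofReal |ψ' t| * g (ψ t)) := by
    refine setLIntegral_mono' measurableSet_Icc fun t ht => ?_
    have hψ't : c ≤ ψ' t := hψ' t ht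
    have habs : |ψ' t| = ψ' t := abs_of_pos (hc.trans_le hψ't)
    have hτle : ENNReal.ofReal (τ t) ≤ ENNReal.ofReal (τmax / c) * ENNReal.ofReal |ψ' t| := by
      rw [← ENNReal.ofReal_mul (div_nonneg hτmax0 hc.le), habs]
      refine ENNReal.ofReal_le_ofReal ?_
      calc τ t ≤ τmax := hτmax t
        _ = τmax / c * c := by field_simp
        _ ≤ τmax / c * ψ' t := mul_le_mul_of_nonneg_left hψ't (div_nonneg hτmax0 hc.le)
    calc g (ψ t) * ENNReal.ofReal (τ t) ≤ g (ψ t) * (ENNReal.ofReal (τmax / c) * ENNReal.ofReal |ψ' t|) :=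
          mul_le_mul' le_rfl hτle
      _ = ENNReal.ofReal (τmax / c) * (ENNReal.ofReal |ψ' t| * g (ψ t)) := by ring
  refine h2.trans ?_
  rw [lintegral_const_mul' _ _ ENNReal.ofReal_ne_top]
  refine mul_le_mul' le_rfl ?_
  -- change of variables
  have hderiv : ∀ t ∈ Set.Icc bm bp, HasDerivWithinAt ψ (ψ' t) (Set.Icc bm bp) t :=
    fun t ht => (hψ t ht).hasDerivWithinAt
  have hcont : ContinuousOn ψ (Set.Icc bm bp) := fun t ht => (hψ t ht).continuousAt.continuousWithinAt
  have hmono : StrictMonoOn ψ (Set.Icc bm bp) := by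
    refine strictMonoOn_of_deriv_pos (convex_Icc bm bp) hcont fun t ht => ?_
    rw [interior_Icc] at ht
    have ht' : t ∈ Set.Icc bm bp := Set.Ioo_subset_Icc_self ht
    rw [(hψ t ht').deriv]
    exact hc.trans_le (hψ' t ht')
  have hinj : Set.InjOn ψ (Set.Icc bm bp) := hmono.injOn
  have hcv := lintegral_image_eq_lintegral_abs_deriv_mul measurableSet_Icc hderiv hinj g
  rw [← hcv]
  -- the image is an interval of length `≤ 1`
  have himg : ψ '' Set.Icc bm bp ⊆ Set.Icc (ψ bm) (ψ bp) := by
    rintro _ ⟨t, ht, rfl⟩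
    exact ⟨hmono.monotoneOn (Set.left_mem_Icc.mpr hle) ht ht.1, hmono.monotoneOn ht (Set.right_mem_Icc.mpr hle) ht.2⟩
  calc ∫⁻ y in ψ '' Set.Icc bm bp, g y ≤ ∫⁻ y in Set.Icc (ψ bm) (ψ bp), g y := lintegral_mono_set himg
    _ ≤ ∫⁻ y in Set.Ioc 0 1, g y := lintegral_Icc_le_of_periodic hg (by linarith)

end Pushforward

/-! ### The crude density bound for the phase chain -/

section Crude

variable {τ : ℝ → ℝ} {bm bp : ℝ}

/-- `finExt b k ∈ [b₋, b₊]` for `b` in the cube (using `b₋ ≤ 0 ≤ b₊`). [folklore] -/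
theorem finExt_mem_Icc_of_cube (hτ : ReducedLawHyp τ bm bp) {n : ℕ} {b : Fin n → ℝ}
    (hb : ∀ i, bm ≤ b i ∧ b i ≤ bp) (k : ℕ) : finExt b k ∈ Set.Icc bm bp := by
  by_cases hk : k < n
  · rw [finExt_of_lt _ hk]; exact ⟨(hb _).1, (hb _).2⟩
  · simp only [finExt, hk, ↓reduceDIte]; exact ⟨hτ.bm_nonpos, hτ.bp_nonneg⟩

/-- `|log P_i| ≤ 5|δ_i|` in the small regime (`|δ| ≤ 1/8`). [cite: AjankiHuveneers2011, Prop. 3.5 eq. (3.19)] -/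
theorem abs_log_pcP_le {δ : ℝ} (hδ : |δ| ≤ 1 / 8) (y : ℝ) : |Real.log (pcP y δ)| ≤ 5 * |δ| := by
  have h := abs_log_pcP_add_le hδ y
  have hs : |2 * δ * Real.sin (2 * π * y)| ≤ 2 * |δ| := by
    rw [abs_mul, abs_mul, abs_two]
    nlinarith [Real.abs_sin_le_one (2 * π * y), abs_nonneg δ]
  have hδ2 : 22 * δ ^ 2 ≤ 3 * |δ| := by
    rw [← sq_abs]; nlinarith [abs_nonneg δ]
  calc |Real.log (pcP y δ)| = |(Real.log (pcP y δ) + 2 * δ * Real.sin (2 * π * y)) - 2 * δ * Real.sin (2 * π * y)| := by ring_nf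
    _ ≤ |Real.log (pcP y δ) + 2 * δ * Real.sin (2 * π * y)| + |2 * δ * Real.sin (2 * π * y)| := abs_sub _ _
    _ ≤ 5 * |δ| := by linarith

/-- **Two-sided control of the cocycle over `L` steps**: in the small regime,
`e^{-5πw b_* L} ≤ J_{j+L}/J_j ≤ e^{5πw b_* L}` (`|log P_i| ≤ 5πw b_*`).
[cite: AjankiHuveneers2011, Prop. 3.5 eqs. (3.19)-(3.21) (`Γ = e^{𝒪(w)·n}` pathwise)] -/
theorem vaJ_ratio_bounds {w x M : ℝ} (hM : 0 ≤ M) (hw0 : 0 ≤ w) (hw : w ≤ pcW M) {B : ℕ → ℝ}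
    (hB : ∀ i, |B i| ≤ M) (j : ℕ) :
    ∀ L : ℕ, Real.exp (-(5 * π * w * M * L)) ≤ vaJ w x B (j + L) / vaJ w x B j ∧
      vaJ w x B (j + L) / vaJ w x B j ≤ Real.exp (5 * π * w * M * L)
  | 0 => by simp [div_self (vaJ_pos w x B j).ne']
  | L + 1 => by
    obtain ⟨ih1, ih2⟩ := vaJ_ratio_bounds hM hw0 hw hB j L
    obtain ⟨hw2, -, hδ⟩ := pc_small hM hw0 hw (hB (j + L))
    have hPpos := vaP_pos w x B (j + L)
    have hJpos := vaJ_pos w x B j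
    have hlog : |Real.log (vaP w x B (j + L))| ≤ 5 * π * w * M := by
      refine (abs_log_pcP_le hδ _).trans ?_
      calc 5 * |igDelta w (B (j + L))| ≤ 5 * (π * w * |B (j + L)|) :=
            mul_le_mul_of_nonneg_left (abs_igDelta_le hw0 hw2 _) (by norm_num)
        _ ≤ 5 * (π * w * M) := by gcongr; exact hB _
        _ = 5 * π * w * M := by ring
    have hinv_lo : Real.exp (-(5 * π * w * M)) ≤ (vaP w x B (j + L))⁻¹ := by
      rw [← Real.exp_log hPpos, ← Real.exp_neg]
      exact Real.exp_le_exp.mpr (by linarith [(abs_le.mp hlog).2])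
    have hinv_hi : (vaP w x B (j + L))⁻¹ ≤ Real.exp (5 * π * w * M) := by
      rw [← Real.exp_log hPpos, ← Real.exp_neg]
      exact Real.exp_le_exp.mpr (by linarith [(abs_le.mp hlog).1])
    rw [show j + (L + 1) = j + L + 1 by omega, vaJ_succ, mul_div_right_comm]
    constructor
    · calc Real.exp (-(5 * π * w * M * (L + 1 : ℕ)))
          = Real.exp (-(5 * π * w * M * L)) * Real.exp (-(5 * π * w * M)) := by
            rw [← Real.exp_add]; push_cast; ring_nf
        _ ≤ vaJ w x B (j + L) / vaJ w x B j * (vaP w x B (j + L))⁻¹ :=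
            mul_le_mul ih1 hinv_lo (Real.exp_pos _).le (div_nonneg (vaJ_pos w x B _).le hJpos.le)
    · calc vaJ w x B (j + L) / vaJ w x B j * (vaP w x B (j + L))⁻¹
          ≤ Real.exp (5 * π * w * M * L) * Real.exp (5 * π * w * M) :=
            mul_le_mul ih2 hinv_hi (inv_pos.mpr hPpos).le (Real.exp_pos _).le
        _ = Real.exp (5 * π * w * M * (L + 1 : ℕ)) := by rw [← Real.exp_add]; push_cast; ring_nf

/-- **The section derivative `∂X_m/∂B_k` in closed form**: `u_k J_m c(w)/(π J_k)` for `k < m`.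
[cite: AjankiHuveneers2011, Lemma 3.2 eqs. (3.8), (3.10)-(3.11)] -/
theorem vaDX_eq {w x : ℝ} (hw0 : 0 < w) (hw : π * w / 2 < 1) (B : ℕ → ℝ) {k m : ℕ} (hkm : k < m) :
    vaDX w x B k m = vaU w x B k * vaJ w x B m * igC w / (π * vaJ w x B k) := by
  have h := vaA_mul_vaDX (x := x) B hw0 hw k m
  simp only [hkm, ↓reduceIte] at h
  have ha := (vaA_pos (x := x) (B := B) hw0 hw k).ne'
  have hc := (igC_pos hw0 hw).ne'
  have hJ := (vaJ_pos w x B k).ne'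
  unfold vaA at h ha
  field_simp at h
  field_simp
  linarith [h]

-- keep the unifier from unfolding the trigonometric polynomials and the chain
attribute [local irreducible] pcP pcPx pcPd igDelta

set_option maxHeartbeats 1600000 in
/-- **Crude (weighted) density bound for the phase chain.** Let `κ' > 0` be small
(`10π b_* κ' ≤ 1`, `b_* = max(|b₋|, |b₊|)`). There are `w₀ > 0` and `C` such that for
`0 < w ≤ w₀`, every split `m₁ ≤ m` of the time interval whose final window has `w`-length in
`[κ', 2κ']` (`κ' ≤ w(m - m₁) ≤ 2κ'`), every start `x`, every measurable `1`-periodic `g ≥ 0`, and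
every measurable weight `F ≥ 0` whose oscillation along each single coordinate OF THE WINDOW is at
most a factor `A` (on the cube): `∫ F g(X^x_m) dτ^{⊗m} ≤ A² (C/w) (∫_{(0,1]} g) ∫ F dτ^{⊗m}`.
The unweighted case `F = 1`, `A = 1` is the `m`-step form of `‖Tu‖_∞ ≤ K' w⁻¹ ‖u‖₁`.
[cite: AjankiHuveneers2011, Lemma 5.4 eq. (5.15) (`∂_b F_x(b) ≳ w`), here iterated along the first good index of the last window (Cor. 3.4 (i))] -/
theorem crude_density_bound_weighted (hτ : ReducedLawHyp τ bm bp) (ρB : Measure ℝ)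
    [IsProbabilityMeasure ρB] (hρ : ρB = volume.withDensity fun s => ENNReal.ofReal (τ s))
    {κ' : ℝ} (hκ' : 0 < κ') (hκ's : 10 * π * max |bm| |bp| * κ' ≤ 1) :
    ∃ w₀ : ℝ, 0 < w₀ ∧ ∃ C : ℝ, 0 ≤ C ∧ ∀ w ∈ Set.Ioc 0 w₀, ∀ m m₁ : ℕ, m₁ ≤ m →
      κ' ≤ w * ((m - m₁ : ℕ) : ℝ) → w * ((m - m₁ : ℕ) : ℝ) ≤ 2 * κ' → ∀ x : ℝ,
      ∀ g : ℝ → ℝ≥0∞, Measurable g → Function.Periodic g 1 →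
      ∀ F : (Fin m → ℝ) → ℝ≥0∞, Measurable F → ∀ A : ℝ≥0∞,
        (∀ j : Fin m, m₁ ≤ j.val → ∀ b : Fin m → ℝ, (∀ i, bm ≤ b i ∧ b i ≤ bp) →
          ∀ t ∈ Set.Icc bm bp, ∀ t' ∈ Set.Icc bm bp,
            F (Function.update b j t) ≤ A * F (Function.update b j t')) →
        ∫⁻ b, F b * g (ahPhase w x (finExt b) m) ∂(Measure.pi fun _ : Fin m => ρB) ≤
          A ^ 2 * ENNReal.ofReal (C / w) * (∫⁻ y in Set.Ioc 0 1, g y) *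
            ∫⁻ b, F b ∂(Measure.pi fun _ : Fin m => ρB) := by
  classical
  -- constants
  set bstar : ℝ := max |bm| |bp| with hbstar
  have hbstar0 : 0 ≤ bstar := le_max_of_le_left (abs_nonneg _)
  have hbm1 : -1 < bm := hτ.lo
  have hbm0 : bm ≤ 0 := hτ.bm_nonpos
  have hbp0 : 0 ≤ bp := hτ.bp_nonneg
  have hlt : bm < bp := hτ.lt
  obtain ⟨w₁, hw₁, η, hη0, -, hsweep⟩ := ahPhase_far_int_card_ge bm bp hbm1 hbm0 hbp0 hκ'
  obtain ⟨τmax, hτmax0, hτmax⟩ := hτ.exists_bound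
  set w₀ : ℝ := min w₁ (min (pcW bstar) (1 / (6 * (bp - bm) + 1))) with hw₀
  have hw₀pos : 0 < w₀ := by
    rw [hw₀]
    refine lt_min hw₁ (lt_min (pcW_pos hbstar0) ?_)
    have : 0 < bp - bm := by linarith
    positivity
  refine ⟨w₀, hw₀pos, τmax / η ^ 2, by positivity, ?_⟩
  intro w hw m m₁ hm₁ hwlo hwhi x g hgm hgper F hFm A hF
  obtain ⟨hw0, hwle⟩ := hw
  have hwa : w ≤ w₁ := hwle.trans (min_le_left _ _)
  have hwb : w ≤ pcW bstar := hwle.trans ((min_le_right _ _).trans (min_le_left _ _))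
  have hwd : w ≤ 1 / (6 * (bp - bm) + 1) := hwle.trans ((min_le_right _ _).trans (min_le_right _ _))
  obtain ⟨hw2, -, -⟩ := pc_small hbstar0 hw0.le hwb (show |(0:ℝ)| ≤ bstar by rw [abs_zero]; exact hbstar0)
  have hwπ : π * w / 2 < 1 := by linarith
  -- `m ≥ 1`
  have hm1 : 1 ≤ m := by
    by_contra h
    push Not at h
    have : m = 0 := by omega
    subst this
    have : m₁ = 0 := by omega
    subst this
    simp at hwlo
    linarith
  obtain ⟨n, rfl⟩ : ∃ n, m = n + 1 := ⟨m - 1, by omega⟩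
  -- the window `[m₁, n+1)` of length `M'`
  set M' : ℕ := n + 1 - m₁ with hM'
  have hk₀M : m₁ + M' = n + 1 := by omega
  have hwM' : κ' ≤ w * M' := hwlo
  have h5 : 5 * π * w * bstar * M' ≤ 1 := by
    have h3 : w * M' ≤ 2 * κ' := hwhi
    calc 5 * π * w * bstar * M' = 5 * π * bstar * (w * M') := by ring
      _ ≤ 5 * π * bstar * (2 * κ') := mul_le_mul_of_nonneg_left h3 (by positivity)
      _ = 10 * π * bstar * κ' := by ring
      _ ≤ 1 := hκ's
  have hM'pos : 0 < M' := by
    refine Nat.pos_of_ne_zero fun h0 => ?_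
    rw [h0, Nat.cast_zero, mul_zero] at hwM'
    linarith
  -- good steps and the first good index of the window
  set μ := (Measure.pi fun _ : Fin (n + 1) => ρB) with hμ
  let X : (Fin (n + 1) → ℝ) → ℕ → ℝ := fun b j => ahPhase w x (finExt b) j
  let good : (Fin (n + 1) → ℝ) → ℕ → Prop := fun b j => 4 * η ^ 2 ≤ Real.sin (π * X b j) ^ 2
  let E : ℕ → Set (Fin (n + 1) → ℝ) := fun j =>
    {b | good b j} ∩ ⋂ j' ∈ (Finset.Ico m₁ (n + 1)).filter (fun j' => j' < j), {b | ¬ good b j'}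
  have hXm : ∀ j, Measurable fun b => X b j := fun j => measurable_ahPhase_pi w x j
  have hgoodm : ∀ j, MeasurableSet {b | good b j} := fun j =>
    measurableSet_le measurable_const ((Real.continuous_sin.measurable.comp
      (measurable_const.mul (hXm j))).pow_const 2)
  have hEm : ∀ j, MeasurableSet (E j) := fun j =>
    (hgoodm j).inter (Finset.measurableSet_biInter _ fun j' _ => (hgoodm j').compl)
  -- (A) the sets `E j`, `j` in the window, cover the cube
  have hcover : ∀ b : Fin (n + 1) → ℝ, (∀ i, bm ≤ b i ∧ b i ≤ bp) →
      ∃ j ∈ Finset.Ico m₁ (n + 1), b ∈ E j := by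
    intro b hb
    have hB : ∀ k, finExt b k ∈ Set.Icc bm bp := finExt_mem_Icc_of_cube hτ hb
    have hcard := hsweep w ⟨hw0, hwa⟩ x (finExt b) hB m₁ M' hwM'
    rw [hk₀M] at hcard
    set G := (Finset.Ico m₁ (n + 1)).filter fun k => 4 * η ^ 2 ≤ Real.sin (π * ahPhase w x (finExt b) k) ^ 2
      with hG
    have hGne : G.Nonempty := by
      rw [← Finset.card_pos]
      have hM'r : (0 : ℝ) < M' := by exact_mod_cast hM'pos
      have : (0 : ℝ) < G.card := by linarith
      exact_mod_cast this
    refine ⟨G.min' hGne, (Finset.mem_filter.mp (G.min'_mem hGne)).1, ?_, ?_⟩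
    · exact (Finset.mem_filter.mp (G.min'_mem hGne)).2
    · simp only [Set.mem_iInter, Finset.mem_filter, Set.mem_setOf_eq]
      intro j' ⟨hj'w, hj'lt⟩ hgood'
      have hmem : j' ∈ G := Finset.mem_filter.mpr ⟨hj'w, hgood'⟩
      exact absurd (G.min'_le j' hmem) (not_le.mpr hj'lt)
  -- (A') the sets `E j` are pairwise disjoint on the window
  have hdisj : ∀ j ∈ Finset.Ico m₁ (n + 1), ∀ j' ∈ Finset.Ico m₁ (n + 1), j ≠ j' → Disjoint (E j) (E j') := by
    intro j hj j' hj' hne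
    rw [Set.disjoint_left]
    intro b hb hb'
    rcases lt_or_gt_of_ne hne with h | h
    · have := hb'.2
      simp only [Set.mem_iInter, Finset.mem_filter, Set.mem_setOf_eq] at this
      exact this j ⟨hj, h⟩ hb.1
    · have := hb.2
      simp only [Set.mem_iInter, Finset.mem_filter, Set.mem_setOf_eq] at this
      exact this j' ⟨hj', h⟩ hb'.1
  -- (B) at most one `E j` contains a given `b`
  have hsum_le : ∀ (Φ : (Fin (n + 1) → ℝ) → ℝ≥0∞) (b : Fin (n + 1) → ℝ),
      ∑ j ∈ Finset.Ico m₁ (n + 1), (E j).indicator Φ b ≤ Φ b := by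
    intro Φ b
    by_cases hex : ∃ j ∈ Finset.Ico m₁ (n + 1), b ∈ E j
    · obtain ⟨j₀, hj₀, hb₀⟩ := hex
      rw [Finset.sum_eq_single_of_mem j₀ hj₀ (fun j hj hne => ?_)]
      · rw [Set.indicator_of_mem hb₀]
      · exact Set.indicator_of_notMem (fun hbj => Set.disjoint_left.mp (hdisj j hj j₀ hj₀ hne) hbj hb₀) _
    · push Not at hex
      rw [Finset.sum_eq_zero (fun j hj => Set.indicator_of_notMem (hex j hj) _)]
      exact zero_le
  -- (C) `E j` does not read the coordinate `j`
  have hEupd : ∀ j (hj : j < n + 1) (b : Fin (n + 1) → ℝ) (t : ℝ),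
      (Function.update b ⟨j, hj⟩ t ∈ E j ↔ b ∈ E j) := by
    intro j hj b t
    have hX : ∀ j', j' ≤ j → X (Function.update b ⟨j, hj⟩ t) j' = X b j' := by
      intro j' hj'
      show ahPhase w x (finExt (Function.update b ⟨j, hj⟩ t)) j' = ahPhase w x (finExt b) j'
      rw [finExt_update, ahPhase_update_of_le w x _ hj']
    simp only [E, Set.mem_inter_iff, Set.mem_setOf_eq, Set.mem_iInter, Finset.mem_filter, good]
    constructor
    · rintro ⟨h1, h2⟩
      refine ⟨by rwa [hX j le_rfl] at h1, fun j' hj' => ?_⟩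
      have := h2 j' hj'; rwa [hX j' hj'.2.le] at this
    · rintro ⟨h1, h2⟩
      refine ⟨by rwa [hX j le_rfl], fun j' hj' => ?_⟩
      have := h2 j' hj'; rwa [hX j' hj'.2.le]
  -- (D) the inner bound along the coordinate `j` (unweighted)
  have hbound : ∀ (j : ℕ) (hjn : j < n + 1), m₁ ≤ j → ∀ b : Fin (n + 1) → ℝ, (∀ i, bm ≤ b i ∧ b i ≤ bp) →
      b ∈ E j → ∫⁻ t, g (X (Function.update b ⟨j, hjn⟩ t) (n + 1)) ∂ρB ≤
        ENNReal.ofReal (τmax / (η ^ 2 * w)) * ∫⁻ y in Set.Ioc 0 1, g y := by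
    intro j hjn hjk₀ b hb hbE
    set B : ℕ → ℝ := finExt b with hBdef
    have hB : ∀ i, |B i| ≤ bstar := fun i => abs_finExt_le hb i
    set ψ : ℝ → ℝ := fun t => ahPhase w x (Function.update B j t) (n + 1) with hψ
    set ψ' : ℝ → ℝ := fun t => vaDX w x (Function.update B j t) j (n + 1) with hψ'
    -- rewrite the integrand through `finExt_update` and the density
    have hG : (fun t => g (X (Function.update b ⟨j, hjn⟩ t) (n + 1))) = fun t => g (ψ t) := by
      funext t
      show g (ahPhase w x (finExt (Function.update b ⟨j, hjn⟩ t)) (n + 1)) = g (ψ t)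
      rw [finExt_update]
    rw [hG]
    have hψm : Measurable ψ := by
      have : ψ = (fun b' : Fin (n + 1) → ℝ => ahPhase w x (finExt b') (n + 1)) ∘ fun t => Function.update b ⟨j, hjn⟩ t := by
        funext t
        show ahPhase w x (Function.update B j t) (n + 1) = ahPhase w x (finExt (Function.update b ⟨j, hjn⟩ t)) (n + 1)
        rw [finExt_update]
      rw [this]
      exact (measurable_ahPhase_pi w x (n + 1)).comp (measurable_update b)
    have hρint : ∫⁻ t, g (ψ t) ∂ρB = ∫⁻ t, g (ψ t) * ENNReal.ofReal (τ t) := by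
      rw [hρ, lintegral_withDensity_eq_lintegral_mul _ hτ.measurable.ennreal_ofReal
        (show Measurable (fun t => g (ψ t)) from hgm.comp hψm)]
      refine lintegral_congr fun t => ?_
      simp only [Pi.mul_apply]
      ring
    rw [hρint]
    -- the hypotheses of the pushforward bound
    have hupdB : ∀ t ∈ Set.Icc bm bp, ∀ i, |Function.update B j t i| ≤ bstar := by
      intro t ht i
      rcases eq_or_ne i j with rfl | hij
      · rw [Function.update_self]; exact ReducedLawHyp.abs_le_of_mem ht
      · rw [Function.update_of_ne hij]; exact hB i
    have hderiv : ∀ t ∈ Set.Icc bm bp, HasDerivAt ψ (ψ' t) t := fun t ht =>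
      hasDerivAt_ahPhase_update' (x := x) hbstar0 hw0 hwb B hB j (ReducedLawHyp.abs_le_of_mem ht) (n + 1)
    -- size of `ψ'`
    have hgoodj : 4 * η ^ 2 ≤ Real.sin (π * X b j) ^ 2 := hbE.1
    have hψ'_bounds : ∀ t ∈ Set.Icc bm bp, η ^ 2 * w ≤ ψ' t ∧ ψ' t ≤ 6 * w := by
      intro t ht
      set B' := Function.update B j t with hB'
      have hB'b := hupdB t ht
      have heq := vaDX_eq (x := x) hw0 hwπ B' hjn
      have hu : vaU w x B' j = 2 * Real.sin (π * X b j) ^ 2 := by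
        rw [hB', vaU_update_of_le w x B le_rfl, vaU_eq_sin_sq]
      have hu_lo : 8 * η ^ 2 ≤ vaU w x B' j := by rw [hu]; linarith
      have hu_hi : vaU w x B' j ≤ 2 := (vaU_bounds w x B' j).2
      obtain ⟨hr_lo, hr_hi⟩ := vaJ_ratio_bounds (x := x) hbstar0 hw0.le hwb hB'b j (n + 1 - j)
      rw [show j + (n + 1 - j) = n + 1 by omega] at hr_lo hr_hi
      have hL : (5 * π * w * bstar * (n + 1 - j : ℕ) : ℝ) ≤ 1 := by
        have : ((n + 1 - j : ℕ) : ℝ) ≤ M' := by exact_mod_cast (show n + 1 - j ≤ M' by omega)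
        calc 5 * π * w * bstar * (n + 1 - j : ℕ) ≤ 5 * π * w * bstar * M' :=
              mul_le_mul_of_nonneg_left this (by positivity)
          _ ≤ 1 := h5
      have hexp_lo : Real.exp (-1) ≤ vaJ w x B' (n + 1) / vaJ w x B' j :=
        le_trans (Real.exp_le_exp.mpr (by linarith)) hr_lo
      have hexp_hi : vaJ w x B' (n + 1) / vaJ w x B' j ≤ Real.exp 1 :=
        hr_hi.trans (Real.exp_le_exp.mpr (by linarith))
      have hJj := vaJ_pos w x B' j
      have hc_lo := le_igC hw0.le hwπ
      have hc_hi := igC_le hw0.le hw2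
      have hratio_pos : 0 < vaJ w x B' (n + 1) / vaJ w x B' j := div_pos (vaJ_pos w x B' _) hJj
      have hψ'eq : ψ' t = vaU w x B' j * (vaJ w x B' (n + 1) / vaJ w x B' j) * (igC w / π) := by
        show vaDX w x B' j (n + 1) = _
        rw [heq]; field_simp
      have he1 : Real.exp 1 ≤ 3 := Real.exp_one_lt_three.le
      have he2 : (1 : ℝ) / 3 ≤ Real.exp (-1) := by
        rw [Real.exp_neg, le_inv_comm₀ (by norm_num) (Real.exp_pos 1)]; linarith
      rw [hψ'eq]
      constructor
      · have hu0 : 0 ≤ vaU w x B' j := le_trans (by positivity) hu_lo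
        have h1 : 8 * η ^ 2 * (1 / 3) * (w / 2) ≤ vaU w x B' j * (vaJ w x B' (n + 1) / vaJ w x B' j) * (igC w / π) := by
          refine mul_le_mul (mul_le_mul hu_lo (he2.trans hexp_lo) (by norm_num) hu0) ?_ (by positivity)
            (mul_nonneg hu0 hratio_pos.le)
          rw [le_div_iff₀ Real.pi_pos]; linarith
        nlinarith [sq_nonneg η]
      · calc vaU w x B' j * (vaJ w x B' (n + 1) / vaJ w x B' j) * (igC w / π)
            ≤ 2 * 3 * w := by
              refine mul_le_mul (mul_le_mul hu_hi (hexp_hi.trans he1) hratio_pos.le (by norm_num)) ?_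
                (div_nonneg (le_trans (by positivity) hc_lo) Real.pi_pos.le) (by norm_num)
              rw [div_le_iff₀ Real.pi_pos]; linarith
          _ = 6 * w := by ring
    have hlen : ψ bp - ψ bm ≤ 1 := by
      have hmvt := (convex_Icc bm bp).norm_image_sub_le_of_norm_hasDerivWithin_le (f := ψ) (f' := ψ')
        (C := 6 * w) (fun t ht => (hderiv t ht).hasDerivWithinAt)
        (fun t ht => by
          rw [Real.norm_eq_abs, abs_of_pos (lt_of_lt_of_le (by positivity) (hψ'_bounds t ht).1)]
          exact (hψ'_bounds t ht).2)
        (Set.left_mem_Icc.mpr hlt.le) (Set.right_mem_Icc.mpr hlt.le)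
      rw [Real.norm_eq_abs, Real.norm_eq_abs, abs_of_pos (sub_pos.mpr hlt)] at hmvt
      have h6 : 6 * w * (bp - bm) ≤ 1 := by
        have : w * (6 * (bp - bm) + 1) ≤ 1 := by
          rw [le_div_iff₀ (by nlinarith)] at hwd; linarith
        nlinarith
      linarith [le_abs_self (ψ bp - ψ bm)]
    exact lintegral_comp_le_of_deriv_ge (ψ := ψ) (ψ' := ψ') hlt.le (by positivity : 0 < η ^ 2 * w)
      hderiv (fun t ht => (hψ'_bounds t ht).1) hlen hτ.nonneg (fun t => (le_abs_self _).trans (hτmax t))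
      hτ.eq_zero hgper
  -- (D') the weighted inner bound
  have haeρ : ∀ᵐ t ∂ρB, t ∈ Set.Icc bm bp := ae_rhoB_mem_Icc hτ hρ
  set bound : ℝ≥0∞ := ENNReal.ofReal (τmax / (η ^ 2 * w)) * ∫⁻ y in Set.Ioc 0 1, g y with hbd
  have hboundW : ∀ (j : ℕ) (hjn : j < n + 1), m₁ ≤ j → ∀ b : Fin (n + 1) → ℝ, (∀ i, bm ≤ b i ∧ b i ≤ bp) →
      b ∈ E j → ∫⁻ t, F (Function.update b ⟨j, hjn⟩ t) * g (X (Function.update b ⟨j, hjn⟩ t) (n + 1)) ∂ρB ≤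
        A ^ 2 * bound * ∫⁻ t, F (Function.update b ⟨j, hjn⟩ t) ∂ρB := by
    intro j hjn hjk₀ b hb hbE
    have hbm_mem : bm ∈ Set.Icc bm bp := Set.left_mem_Icc.mpr hlt.le
    have hFt : ∀ t ∈ Set.Icc bm bp, F (Function.update b ⟨j, hjn⟩ t) ≤ A * F (Function.update b ⟨j, hjn⟩ bm) :=
      fun t ht => hF ⟨j, hjn⟩ hjk₀ b hb t ht bm hbm_mem
    have hFbm : ∀ t' ∈ Set.Icc bm bp, F (Function.update b ⟨j, hjn⟩ bm) ≤ A * F (Function.update b ⟨j, hjn⟩ t') :=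
      fun t' ht' => hF ⟨j, hjn⟩ hjk₀ b hb bm hbm_mem t' ht'
    have hgt : Measurable fun t => g (X (Function.update b ⟨j, hjn⟩ t) (n + 1)) :=
      hgm.comp ((hXm (n + 1)).comp (measurable_update b))
    calc ∫⁻ t, F (Function.update b ⟨j, hjn⟩ t) * g (X (Function.update b ⟨j, hjn⟩ t) (n + 1)) ∂ρB
        ≤ ∫⁻ t, A * F (Function.update b ⟨j, hjn⟩ bm) * g (X (Function.update b ⟨j, hjn⟩ t) (n + 1)) ∂ρB := by
          refine lintegral_mono_ae (haeρ.mono fun t ht => ?_)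
          exact mul_le_mul' (hFt t ht) le_rfl
      _ = A * F (Function.update b ⟨j, hjn⟩ bm) * ∫⁻ t, g (X (Function.update b ⟨j, hjn⟩ t) (n + 1)) ∂ρB :=
          lintegral_const_mul _ hgt
      _ ≤ A * F (Function.update b ⟨j, hjn⟩ bm) * bound := mul_le_mul' le_rfl (hbound j hjn hjk₀ b hb hbE)
      _ = ∫⁻ _t, A * F (Function.update b ⟨j, hjn⟩ bm) * bound ∂ρB := by
          rw [lintegral_const, measure_univ, mul_one]
      _ ≤ ∫⁻ t, A * (A * F (Function.update b ⟨j, hjn⟩ t)) * bound ∂ρB := by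
          refine lintegral_mono_ae (haeρ.mono fun t ht => ?_)
          exact mul_le_mul' (mul_le_mul' le_rfl (hFbm t ht)) le_rfl
      _ = ∫⁻ t, A ^ 2 * bound * F (Function.update b ⟨j, hjn⟩ t) ∂ρB :=
          lintegral_congr fun t => by ring
      _ = A ^ 2 * bound * ∫⁻ t, F (Function.update b ⟨j, hjn⟩ t) ∂ρB :=
          lintegral_const_mul _ (hFm.comp (measurable_update b))
  -- assembly
  have hae : ∀ᵐ b ∂μ, ∀ i, bm ≤ b i ∧ b i ≤ bp := ae_pi_mem_Icc hτ.eq_zero hρ (n + 1)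
  rw [div_div]
  have hFg : Measurable fun b : Fin (n + 1) → ℝ => F b * g (X b (n + 1)) := hFm.mul (hgm.comp (hXm (n + 1)))
  calc ∫⁻ b, F b * g (X b (n + 1)) ∂μ
      ≤ ∫⁻ b, ∑ j ∈ Finset.Ico m₁ (n + 1), (E j).indicator (fun b => F b * g (X b (n + 1))) b ∂μ := by
        refine lintegral_mono_ae (hae.mono fun b hb => ?_)
        obtain ⟨j, hj, hbj⟩ := hcover b hb
        calc F b * g (X b (n + 1)) = (E j).indicator (fun b => F b * g (X b (n + 1))) b := by
              rw [Set.indicator_of_mem hbj]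
          _ ≤ ∑ j ∈ Finset.Ico m₁ (n + 1), (E j).indicator (fun b => F b * g (X b (n + 1))) b :=
              Finset.single_le_sum (f := fun j => (E j).indicator (fun b => F b * g (X b (n + 1))) b)
                (fun _ _ => zero_le) hj
    _ = ∑ j ∈ Finset.Ico m₁ (n + 1), ∫⁻ b, (E j).indicator (fun b => F b * g (X b (n + 1))) b ∂μ :=
        lintegral_finsetSum' _ fun j _ => (hFg.indicator (hEm j)).aemeasurable
    _ ≤ ∑ j ∈ Finset.Ico m₁ (n + 1), A ^ 2 * bound * ∫⁻ b, (E j).indicator F b ∂μ := by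
        refine Finset.sum_le_sum fun j hj => ?_
        have hjn : j < n + 1 := (Finset.mem_Ico.mp hj).2
        have hjm₁ : m₁ ≤ j := (Finset.mem_Ico.mp hj).1
        rw [lintegral_pi_update ρB ⟨j, hjn⟩ _ (hFg.indicator (hEm j)),
          lintegral_pi_update ρB ⟨j, hjn⟩ _ (hFm.indicator (hEm j))]
        have hpt : ∀ (Φ : (Fin (n + 1) → ℝ) → ℝ≥0∞) (b : Fin (n + 1) → ℝ),
            ∫⁻ t, (E j).indicator Φ (Function.update b ⟨j, hjn⟩ t) ∂ρB =
              (E j).indicator (fun b => ∫⁻ t, Φ (Function.update b ⟨j, hjn⟩ t) ∂ρB) b := by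
          intro Φ b
          by_cases hbE : b ∈ E j
          · rw [Set.indicator_of_mem hbE]
            refine lintegral_congr fun t => ?_
            rw [Set.indicator_of_mem ((hEupd j hjn b t).mpr hbE)]
          · rw [Set.indicator_of_notMem hbE]
            refine (lintegral_congr fun t => ?_).trans lintegral_zero
            rw [Set.indicator_of_notMem (fun h => hbE ((hEupd j hjn b t).mp h))]
        simp only [hpt]
        have hmeasU : Measurable fun b : Fin (n + 1) → ℝ => ∫⁻ t, F (Function.update b ⟨j, hjn⟩ t) ∂ρB :=
          (hFm.comp measurable_update').lintegral_prod_right'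
        calc ∫⁻ b, (E j).indicator (fun b => ∫⁻ t, F (Function.update b ⟨j, hjn⟩ t) *
                g (X (Function.update b ⟨j, hjn⟩ t) (n + 1)) ∂ρB) b ∂μ
            ≤ ∫⁻ b, A ^ 2 * bound * (E j).indicator
                (fun b => ∫⁻ t, F (Function.update b ⟨j, hjn⟩ t) ∂ρB) b ∂μ := by
              refine lintegral_mono_ae (hae.mono fun b hb => ?_)
              by_cases hbE : b ∈ E j
              · rw [Set.indicator_of_mem hbE, Set.indicator_of_mem hbE]
                exact hboundW j hjn hjm₁ b hb hbE
              · rw [Set.indicator_of_notMem hbE, Set.indicator_of_notMem hbE, mul_zero]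
          _ = A ^ 2 * bound * ∫⁻ b, (E j).indicator
                (fun b => ∫⁻ t, F (Function.update b ⟨j, hjn⟩ t) ∂ρB) b ∂μ :=
              lintegral_const_mul'' _ (hmeasU.indicator (hEm j)).aemeasurable
    _ = A ^ 2 * bound * ∑ j ∈ Finset.Ico m₁ (n + 1), ∫⁻ b, (E j).indicator F b ∂μ := by
        rw [Finset.mul_sum]
    _ = A ^ 2 * bound * ∫⁻ b, ∑ j ∈ Finset.Ico m₁ (n + 1), (E j).indicator F b ∂μ := by
        rw [lintegral_finsetSum' _ fun j _ => (hFm.indicator (hEm j)).aemeasurable]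
    _ ≤ A ^ 2 * bound * ∫⁻ b, F b ∂μ :=
        mul_le_mul' le_rfl (lintegral_mono fun b => hsum_le F b)
    _ = A ^ 2 * ENNReal.ofReal (τmax / (η ^ 2 * w)) * (∫⁻ y in Set.Ioc 0 1, g y) * ∫⁻ b, F b ∂μ := by
        rw [hbd]; ring

end Crude

end Literature.Barriers.AtomisticToContinuum.HeatConduction

end
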